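import Literature.MathematicalPhysics.QuantumFieldTheory.Balaban1983to89.B10Eq18SigmaSU2Haar
import Literature.MathematicalPhysics.QuantumFieldTheory.Balaban1983to89.B16ZLower
import Literature.MathematicalPhysics.QuantumFieldTheory.Balaban1983to89.B10Eq71TorusLocal

/-!
# Route `CoarseStiffnessTail` — THE COMMUTATOR OF TWO `SU(2)` ELEMENTS IN THE EXPONENTIAL CHART:
# `Re tr[e^{iA}, e^{iB}] = 1 − 2·sinc²|A|·sinc²|B|·(|A|²|B|² − (A·B)²)` (lead's certificate, seat `ym-line-cst-p1` g15; helper on 25301, stub S3, P2/(W1))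

THE IDENTITY (`reTr_comm_expPauli`): for `A, B ∈ ℝ³` and print's chart `expPauli A = exp(iΣσ_aA^a)` ([Balaban1985UV3] p.260, the tree's
`B10Eq18SigmaSU2Haar`), with the NORMALISED trace `reTr = Re Tr/2` of the tree's `SU(N)` model:

  `reTr(e^{iA} e^{iB} e^{−iA} e^{−iB}) = 1 − 2·sinc²‖A‖·sinc²‖B‖·(‖A‖²‖B‖² − ⟪A,B⟫²)`.

Geometrically: `e^{iA} = cos|A| + sin|A|·Â·iσ` is the unit quaternion with vector part `u⃗ = sin|A|·Â`, and `Re([u,v]) = 1 − 2|u⃗ × v⃗|²`;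
`|u⃗ × v⃗|² = |u⃗|²|v⃗|² − (u⃗·v⃗)²` (Lagrange).  PROOF: Euler's formula `exp(iA) = cos|A|·1 + sinc|A|·iA` (`exp_su2Coord`),
`(iA)ᴴ = −iA`, the trace of the four-fold product of the explicit `2 × 2` matrices is a polynomial identity (`trace_comm_word_re`, `ring`),
and `cos² + sinc²·|A|² = 1`.

CONSEQUENCES (§3): `1 − reTr[e^{iA},e^{iB}] = 2 sinc²sinc²·K(A,B)` with `K(A,B) = ‖A‖²‖B‖² − ⟪A,B⟫² ≥ 0`; on the quarter ball `‖A‖,‖B‖ ≤ π/2`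
(where `sinc ≥ 2/π`): `1 − reTr ≥ (32/π⁴)·K(A,B)` (`one_sub_reTr_comm_ge_on_quarter`); everywhere: `dist1([e^{iA},e^{iB}])² ≤ 8·K(A,B)`
(`dist1_comm_sq_le`, from the tree's `|W − 1|² ≤ 2N(1 − Re tr W)` and `sinc ≤ 1`).

WHY (line card §g15, P2).  The exact Laplace exponent of the torus partition function hinges on the `ε⁴` law of `ε`-almost-commuting
`SU(2)` TRIPLES; this identity turns commutator defects into the explicit quartic `K(A,B) = Σ_{i<j}(A_iB_j − A_jB_i)²` on `ℝ³`, where the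
volume computations of the companions (`…LCommVolumeUpper`, `…LCommVolumeLower`) are done with Lebesgue measure.

HONEST SCOPE.  Matrix algebra; nothing of Bałaban's is asserted; the crux 25301, its stubs S1/S2/S3, `HistoryTailL` 19936 stay OPEN;
`YM3TorusSU2` (R3, RECORD rung, not Clay) is NOT proved; the Yang–Mills mass gap is NOT touched.

References: T. Bałaban, CMP **102** (1985) 255–275 [Balaban1985UV3] (p.260, the chart `σ(A)dA`); I. Montvay, G. Münster, *Quantum Fields on a
Lattice* (1994) §3.2.3 (3.96) [MontvayMunster1994].
-/

noncomputable section

open Complex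
open scoped Real

namespace Summit.QuantumFields.YangMills.Theorems.CoarseStiffnessTailCommutatorChart

open Literature.MathematicalPhysics.QuantumFieldTheory.Balaban1983to89
open Literature.MathematicalPhysics.QuantumFieldTheory.Balaban1983to89.B10Eq18SigmaSU2 (su2Coord)
open Literature.MathematicalPhysics.QuantumFieldTheory.Balaban1983to89.B10Eq18SigmaSU2Haar (expPauli coe_expPauli exp_su2Coord)
open Literature.MathematicalPhysics.QuantumFieldTheory.Balaban1983to89.B16ZLower (reTr_specialUnitaryGroup)
open Literature.MathematicalPhysics.QuantumFieldTheory.Balaban1983to89.B10Eq71TorusLocal (dist1_sq_le_specialUnitaryGroup)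

/-! ## §1 The explicit matrices -/

section Matrices

/-- The raw trace identity for the commutator word of two Euler-form `2 × 2` matrices
`U = c₁ + s₁X(a)`, `V = c₂ + s₂X(b)`, `X(a) = iΣ a_kσ_k`:
`Re tr(U V U⁻ V⁻) = 2(c₁² + s₁²|a|²)(c₂² + s₂²|b|²) − 4 s₁²s₂²(|a|²|b|² − (a·b)²)` with `U⁻ = c₁ − s₁X(a)`. [folklore] -/
theorem trace_comm_word_re (c₁ s₁ c₂ s₂ a0 a1 a2 b0 b1 b2 : ℝ) :
    (Matrix.trace
      ((!![(c₁ : ℂ) + s₁ * (a2 * I), s₁ * (a0 * I + a1); s₁ * (a0 * I - a1), c₁ - s₁ * (a2 * I)] : Matrix (Fin 2) (Fin 2) ℂ) *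
       !![(c₂ : ℂ) + s₂ * (b2 * I), s₂ * (b0 * I + b1); s₂ * (b0 * I - b1), c₂ - s₂ * (b2 * I)] *
       !![(c₁ : ℂ) - s₁ * (a2 * I), -(s₁ * (a0 * I + a1)); -(s₁ * (a0 * I - a1)), c₁ + s₁ * (a2 * I)] *
       !![(c₂ : ℂ) - s₂ * (b2 * I), -(s₂ * (b0 * I + b1)); -(s₂ * (b0 * I - b1)), c₂ + s₂ * (b2 * I)])).re =
      2 * (c₁ ^ 2 + s₁ ^ 2 * (a0 ^ 2 + a1 ^ 2 + a2 ^ 2)) * (c₂ ^ 2 + s₂ ^ 2 * (b0 ^ 2 + b1 ^ 2 + b2 ^ 2)) -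
        4 * s₁ ^ 2 * s₂ ^ 2 * ((a0 ^ 2 + a1 ^ 2 + a2 ^ 2) * (b0 ^ 2 + b1 ^ 2 + b2 ^ 2) - (a0 * b0 + a1 * b1 + a2 * b2) ^ 2) := by
  simp [Matrix.trace_fin_two]
  ring

/-- Euler's matrix: `c·1 + s·X(A)` written out. [folklore] -/
theorem smul_one_add_smul_su2Coord (c s : ℝ) (A : EuclideanSpace ℝ (Fin 3)) :
    (c : ℂ) • (1 : Matrix (Fin 2) (Fin 2) ℂ) + (s : ℂ) • su2Coord A =
      !![(c : ℂ) + s * (A 2 * I), s * (A 0 * I + A 1); s * (A 0 * I - A 1), c - s * (A 2 * I)] := by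
  ext i j
  (fin_cases i <;> fin_cases j <;> simp [su2Coord]); ring

/-- … and `c·1 − s·X(A)`. [folklore] -/
theorem smul_one_sub_smul_su2Coord (c s : ℝ) (A : EuclideanSpace ℝ (Fin 3)) :
    (c : ℂ) • (1 : Matrix (Fin 2) (Fin 2) ℂ) - (s : ℂ) • su2Coord A =
      !![(c : ℂ) - s * (A 2 * I), -(s * (A 0 * I + A 1)); -(s * (A 0 * I - A 1)), c + s * (A 2 * I)] := by
  ext i j
  fin_cases i <;> fin_cases j <;> simp [su2Coord]

/-- `X(A)` is skew-Hermitian: `X(A)ᴴ = −X(A)`. [folklore] -/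
theorem star_su2Coord (A : EuclideanSpace ℝ (Fin 3)) : star (su2Coord A) = -su2Coord A := by
  ext i j
  fin_cases i <;> fin_cases j <;> simp [su2Coord, Matrix.star_apply, Complex.ext_iff]

/-- The matrix of `(exp iA)⁻¹`: `cos|A|·1 − sinc|A|·iA`. [folklore] -/
theorem coe_inv_expPauli (A : EuclideanSpace ℝ (Fin 3)) :
    (((expPauli A)⁻¹ : Matrix.specialUnitaryGroup (Fin 2) ℂ) : Matrix (Fin 2) (Fin 2) ℂ) =
      (Real.cos ‖A‖ : ℂ) • (1 : Matrix (Fin 2) (Fin 2) ℂ) - (Real.sinc ‖A‖ : ℂ) • su2Coord A := by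
  show star ((expPauli A : Matrix.specialUnitaryGroup (Fin 2) ℂ) : Matrix (Fin 2) (Fin 2) ℂ) = _
  rw [coe_expPauli, exp_su2Coord, star_add, star_smul, star_smul, star_one, star_su2Coord]
  simp only [RCLike.star_def, Complex.conj_ofReal, smul_neg, sub_eq_add_neg]

/-- `cos²|A| + sinc²|A|·|A|² = 1`. [folklore] -/
theorem cos_sq_add_sinc_sq_mul (r : ℝ) : Real.cos r ^ 2 + Real.sinc r ^ 2 * r ^ 2 = 1 := by
  by_cases hr : r = 0
  · subst hr; simp
  · rw [Real.sinc_of_ne_zero hr, div_pow, div_mul_cancel₀ _ (pow_ne_zero 2 hr)]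
    exact Real.cos_sq_add_sin_sq r

/-- `‖A‖² = A₀² + A₁² + A₂²` on `ℝ³`. [folklore] -/
theorem norm_sq_eq_three (A : EuclideanSpace ℝ (Fin 3)) : ‖A‖ ^ 2 = A 0 ^ 2 + A 1 ^ 2 + A 2 ^ 2 := by
  rw [EuclideanSpace.real_norm_sq_eq, Fin.sum_univ_three]

/-- `⟪A, B⟫ = A₀B₀ + A₁B₁ + A₂B₂` on `ℝ³`. [folklore] -/
theorem inner_eq_three (A B : EuclideanSpace ℝ (Fin 3)) : inner ℝ A B = A 0 * B 0 + A 1 * B 1 + A 2 * B 2 := by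
  simp [PiLp.inner_apply, Fin.sum_univ_three]
  ring

end Matrices

/-! ## §2 The commutator in the chart -/

section Commutator

/-- **★★ THE COMMUTATOR OF TWO `SU(2)` ELEMENTS IN THE EXPONENTIAL CHART**:
`reTr(e^{iA} e^{iB} (e^{iA})⁻¹ (e^{iB})⁻¹) = 1 − 2·sinc²‖A‖·sinc²‖B‖·(‖A‖²‖B‖² − ⟪A,B⟫²)`. [folklore] -/
theorem reTr_comm_expPauli (A B : EuclideanSpace ℝ (Fin 3)) :
    reTr (expPauli A * expPauli B * (expPauli A)⁻¹ * (expPauli B)⁻¹) =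
      1 - 2 * Real.sinc ‖A‖ ^ 2 * Real.sinc ‖B‖ ^ 2 * (‖A‖ ^ 2 * ‖B‖ ^ 2 - inner ℝ A B ^ 2) := by
  rw [reTr_specialUnitaryGroup, UnitaryModel.nReTr]
  simp only [Submonoid.coe_mul, coe_inv_expPauli, coe_expPauli, exp_su2Coord, smul_one_add_smul_su2Coord,
    smul_one_sub_smul_su2Coord, Fintype.card_fin]
  rw [trace_comm_word_re]
  have hA := cos_sq_add_sinc_sq_mul ‖A‖
  have hB := cos_sq_add_sinc_sq_mul ‖B‖
  rw [norm_sq_eq_three] at hA hB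
  rw [norm_sq_eq_three, norm_sq_eq_three, inner_eq_three]
  push_cast
  linear_combination (1 * (Real.cos ‖B‖ ^ 2 + Real.sinc ‖B‖ ^ 2 * (B 0 ^ 2 + B 1 ^ 2 + B 2 ^ 2))) * hA + 1 * hB

end Commutator

/-! ## §3 Consequences: the quartic `K(A,B) = ‖A‖²‖B‖² − ⟪A,B⟫²` -/

section Quartic

/-- `K(A,B) = ‖A‖²‖B‖² − ⟪A,B⟫² ≥ 0` (Cauchy–Schwarz). [folklore] -/
theorem quartic_nonneg (A B : EuclideanSpace ℝ (Fin 3)) : 0 ≤ ‖A‖ ^ 2 * ‖B‖ ^ 2 - inner ℝ A B ^ 2 := by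
  have h := abs_real_inner_le_norm A B
  have h2 : inner ℝ A B ^ 2 ≤ (‖A‖ * ‖B‖) ^ 2 := by
    rw [← sq_abs (inner ℝ A B)]
    exact pow_le_pow_left₀ (abs_nonneg _) h 2
  nlinarith

/-- `1 − reTr[e^{iA},e^{iB}] = 2 sinc²‖A‖ sinc²‖B‖ K(A,B)`. [folklore] -/
theorem one_sub_reTr_comm_expPauli (A B : EuclideanSpace ℝ (Fin 3)) :
    1 - reTr (expPauli A * expPauli B * (expPauli A)⁻¹ * (expPauli B)⁻¹) =
      2 * Real.sinc ‖A‖ ^ 2 * Real.sinc ‖B‖ ^ 2 * (‖A‖ ^ 2 * ‖B‖ ^ 2 - inner ℝ A B ^ 2) := by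
  rw [reTr_comm_expPauli]; ring

/-- On `[0, π/2]`: `sinc r ≥ 2/π` (Jordan). [folklore] -/
theorem two_div_pi_le_sinc {r : ℝ} (hr0 : 0 ≤ r) (hr : r ≤ π / 2) : 2 / π ≤ Real.sinc r := by
  by_cases h : r = 0
  · subst h; rw [Real.sinc_zero]
    have : (2 : ℝ) / π ≤ 1 := by rw [div_le_one Real.pi_pos]; linarith [Real.pi_gt_three]
    exact this
  · rw [Real.sinc_of_ne_zero h, le_div_iff₀ (lt_of_le_of_ne hr0 (Ne.symm h))]
    exact Real.mul_le_sin hr0 hr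

/-- **ON THE QUARTER BALLS `‖A‖, ‖B‖ ≤ π/2`: `1 − reTr[e^{iA},e^{iB}] ≥ (32/π⁴)·K(A,B)`.** [folklore] -/
theorem one_sub_reTr_comm_ge_on_quarter {A B : EuclideanSpace ℝ (Fin 3)} (hA : ‖A‖ ≤ π / 2) (hB : ‖B‖ ≤ π / 2) :
    32 / π ^ 4 * (‖A‖ ^ 2 * ‖B‖ ^ 2 - inner ℝ A B ^ 2) ≤
      1 - reTr (expPauli A * expPauli B * (expPauli A)⁻¹ * (expPauli B)⁻¹) := by
  rw [one_sub_reTr_comm_expPauli]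
  have hK := quartic_nonneg A B
  have ha := two_div_pi_le_sinc (norm_nonneg A) hA
  have hb := two_div_pi_le_sinc (norm_nonneg B) hB
  have hπ : 0 < π := Real.pi_pos
  have h2 : 0 ≤ 2 / π := by positivity
  have ha2 : (2 / π) ^ 2 ≤ Real.sinc ‖A‖ ^ 2 := pow_le_pow_left₀ h2 ha 2
  have hb2 : (2 / π) ^ 2 ≤ Real.sinc ‖B‖ ^ 2 := pow_le_pow_left₀ h2 hb 2
  have hprod : (2 / π) ^ 2 * (2 / π) ^ 2 ≤ Real.sinc ‖A‖ ^ 2 * Real.sinc ‖B‖ ^ 2 :=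
    mul_le_mul ha2 hb2 (by positivity) (sq_nonneg _)
  have heq : (32 : ℝ) / π ^ 4 = 2 * ((2 / π) ^ 2 * (2 / π) ^ 2) := by field_simp; ring
  rw [heq]
  nlinarith

/-- **EVERYWHERE: `dist1([e^{iA},e^{iB}])² ≤ 8·K(A,B)`** (`|W − 1|² ≤ 4(1 − reTr W)` on `SU(2)`, `sinc² ≤ 1`). [folklore] -/
theorem dist1_comm_sq_le (A B : EuclideanSpace ℝ (Fin 3)) :
    dist1 (expPauli A * expPauli B * (expPauli A)⁻¹ * (expPauli B)⁻¹) ^ 2 ≤ 8 * (‖A‖ ^ 2 * ‖B‖ ^ 2 - inner ℝ A B ^ 2) := by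
  have h := dist1_sq_le_specialUnitaryGroup (N := 2) (expPauli A * expPauli B * (expPauli A)⁻¹ * (expPauli B)⁻¹)
  rw [one_sub_reTr_comm_expPauli] at h
  have hK := quartic_nonneg A B
  have hsA : Real.sinc ‖A‖ ^ 2 ≤ 1 := by
    have := Real.abs_sinc_le_one ‖A‖
    have h0 : 0 ≤ |Real.sinc ‖A‖| := abs_nonneg _
    calc Real.sinc ‖A‖ ^ 2 = |Real.sinc ‖A‖| ^ 2 := (sq_abs _).symm
      _ ≤ 1 ^ 2 := pow_le_pow_left₀ h0 this 2
      _ = 1 := one_pow 2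
  have hsB : Real.sinc ‖B‖ ^ 2 ≤ 1 := by
    have := Real.abs_sinc_le_one ‖B‖
    have h0 : 0 ≤ |Real.sinc ‖B‖| := abs_nonneg _
    calc Real.sinc ‖B‖ ^ 2 = |Real.sinc ‖B‖| ^ 2 := (sq_abs _).symm
      _ ≤ 1 ^ 2 := pow_le_pow_left₀ h0 this 2
      _ = 1 := one_pow 2
  have hss : Real.sinc ‖A‖ ^ 2 * Real.sinc ‖B‖ ^ 2 ≤ 1 := mul_le_one₀ hsA (sq_nonneg _) hsB
  push_cast at h
  nlinarith [sq_nonneg (Real.sinc ‖A‖), sq_nonneg (Real.sinc ‖B‖)]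

end Quartic

end Summit.QuantumFields.YangMills.Theorems.CoarseStiffnessTailCommutatorChart

end
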